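import Mathlib
import Summits.ValiantsHypothesis.ValiantsHypothesis.Theorems.LacunarySymmetroidMatrixDescartesInertiaEndInertias
import Summits.ValiantsHypothesis.ValiantsHypothesis.Theorems.LacunarySymmetroidMatrixDescartesInertiaIndexFormula
import Summits.ValiantsHypothesis.ValiantsHypothesis.Theorems.LacunarySymmetroidMatrixDescartesInertiaParity

/-!
# `MatrixDescartes` (stmt-ValiantsHypothesis-18050) — INERTIA KIT, IV-f: THE GLOBAL INDEX FORMULA — for every real symmetric
# lacunary pencil with non-singular extreme letters whose positive roots are of definite type,
# `Z₊ = |ν(S_top) − ν(S_bottom)| + 2·min(N⁻, N⁺)` with multiplicity; and `Z₊ ≡ ν(S_top) + ν(S_bottom) (mod 2)` with no hypothesis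

HONEST FRAMING.  Cell `pub-symmetroid`, seat `val-sym-mdr-p2` (gen 17); helper file `--supports` the crux
`Theses.LacunarySymmetroid.MatrixDescartes`, NO closure claim.  General theorems for EVERY real symmetric lacunary pencil
`F(X) = ∑ₖ X^{dₖ}Sₖ` whose exponents have a unique minimum `d_{l₀}` and a unique maximum `d_{l₁}` with `S_{l₀}`, `S_{l₁}` non-singular
(any index types, any format).  Nothing here bears on the crux in its window, on `stub_twoSided`, on `DoorA26`/`DoorA34`, registers, or
`VP ≠ VNP`.

CONTENT.  (§2) THE GLOBAL INDEX FORMULA `global_index_formula`: if every positive root of `det F` is of definite type then, with `N⁻` / `N⁺`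
the negative- / positive-type positive roots counted with multiplicity, `ν(S_{l₁}) + N⁺ = ν(S_{l₀}) + N⁻`, `π(S_{l₁}) + N⁻ = π(S_{l₀}) + N⁺`
and `N⁻ + N⁺ = Z₊` (with multiplicity): THE NET NUMBER OF DOWNWARD EIGENVALUE CROSSINGS IS A BOUNDARY TERM FIXED BY THE TWO EXTREME
LETTERS, so `Z₊ = |ν(S_{l₁}) − ν(S_{l₀})| + 2·min(N⁻, N⁺) ≤ m + 2·min(N⁻, N⁺)` — every positive root beyond the
Descartes-with-multiplicity-`m` budget comes with a partner of the OPPOSITE type (end inertias `…InertiaEndInertias` + the window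
index formula `Inertia.index_formula`).  (§3) EXACT ONE-TYPE COUNTS `card_posRoots_multiset_eq_of_negType` / `…_of_posType`: all
positive roots of negative type ⇒ `Z₊ + ν(S_{l₀}) = ν(S_{l₁})` exactly (positive type: `Z₊ + ν(S_{l₁}) = ν(S_{l₀})`) — e.g. on g16's
one-crossing sector with `S₀ ≻ 0` the count is EXACTLY `ν(S_{K−1})`.  (§4) PARITY OF `Z₊` `even_card_posRoots_add` (no type
hypothesis): `Z₊ + ν(S_{l₀}) + ν(S_{l₁})` is even (g16's parity law `Inertia.even_negIndex_add_negIndex_add_card_roots` between the two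
ends). [folklore]; axioms standard; no definitions.
-/

-- layout Summits/ValiantsHypothesis/ValiantsHypothesis forces the duplicated namespace component
set_option linter.dupNamespace false

namespace Summit.ValiantsHypothesis.ValiantsHypothesis.Theorems.LacunarySymmetroidMatrixDescartes

open Matrix Finset Polynomial
open scoped BigOperators Topology

namespace Inertia

variable {ι : Type} [Fintype ι] [DecidableEq ι]

section Pencil

variable {κ : Type} [Fintype κ]

/-! ## §2 The global index formula -/

/-- **THE GLOBAL INDEX FORMULA.**  `F(X) = ∑ₖ X^{dₖ}Sₖ` real symmetric with unique extreme exponents `d_{l₀} < ⋯ < d_{l₁}` and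
`S_{l₀}`, `S_{l₁}` non-singular; every positive root of `det F` of definite type; `N⁻`, `N⁺` = the negative-type and the remaining
(positive-type) positive roots counted with multiplicity.  Then `ν(S_{l₁}) + N⁺ = ν(S_{l₀}) + N⁻`, `π(S_{l₁}) + N⁻ = π(S_{l₀}) + N⁺`, and
`N⁻ + N⁺ = Z₊` (with multiplicity). [folklore] -/
theorem global_index_formula (d : κ → ℕ) (S : κ → Matrix ι ι ℝ) (hS : ∀ k, (S k).IsSymm) (l₀ l₁ : κ)
    (hmin : ∀ l, l ≠ l₀ → d l₀ < d l) (hmax : ∀ l, l ≠ l₁ → d l < d l₁) (h₀ : (S l₀).det ≠ 0) (h₁ : (S l₁).det ≠ 0)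
    (htype : ∀ t, 0 < t → (∑ k, t ^ d k • S k).det = 0 →
      (∀ u : ι → ℝ, (∑ k, t ^ d k • S k) *ᵥ u = 0 → u ≠ 0 →
        (derivative (∑ k, C (u ⬝ᵥ (S k *ᵥ u)) * (X : ℝ[X]) ^ d k)).eval t < 0) ∨
      (∀ u : ι → ℝ, (∑ k, t ^ d k • S k) *ᵥ u = 0 → u ≠ 0 →
        0 < (derivative (∑ k, C (u ⬝ᵥ (S k *ᵥ u)) * (X : ℝ[X]) ^ d k)).eval t))
    (negType : ℝ → Prop) [DecidablePred negType]
    (hnegType : ∀ t, 0 < t → (∑ k, t ^ d k • S k).det = 0 →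
      (negType t ↔ ∀ u : ι → ℝ, (∑ k, t ^ d k • S k) *ᵥ u = 0 → u ≠ 0 →
        (derivative (∑ k, C (u ⬝ᵥ (S k *ᵥ u)) * (X : ℝ[X]) ^ d k)).eval t < 0)) :
    Fintype.card {j // (isHermitian_of_isSymm (hS l₁)).eigenvalues j < 0}
        + Multiset.card ((Matrix.det (∑ k, ((X : ℝ[X]) ^ d k) • (S k).map C)).roots.filter (fun t => 0 < t ∧ ¬ negType t))
      = Fintype.card {j // (isHermitian_of_isSymm (hS l₀)).eigenvalues j < 0}
        + Multiset.card ((Matrix.det (∑ k, ((X : ℝ[X]) ^ d k) • (S k).map C)).roots.filter (fun t => 0 < t ∧ negType t)) ∧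
    Fintype.card {j // 0 < (isHermitian_of_isSymm (hS l₁)).eigenvalues j}
        + Multiset.card ((Matrix.det (∑ k, ((X : ℝ[X]) ^ d k) • (S k).map C)).roots.filter (fun t => 0 < t ∧ negType t))
      = Fintype.card {j // 0 < (isHermitian_of_isSymm (hS l₀)).eigenvalues j}
        + Multiset.card ((Matrix.det (∑ k, ((X : ℝ[X]) ^ d k) • (S k).map C)).roots.filter (fun t => 0 < t ∧ ¬ negType t)) ∧
    Multiset.card ((Matrix.det (∑ k, ((X : ℝ[X]) ^ d k) • (S k).map C)).roots.filter (fun t => 0 < t ∧ negType t))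
        + Multiset.card ((Matrix.det (∑ k, ((X : ℝ[X]) ^ d k) • (S k).map C)).roots.filter (fun t => 0 < t ∧ ¬ negType t))
      = Multiset.card ((Matrix.det (∑ k, ((X : ℝ[X]) ^ d k) • (S k).map C)).roots.filter (fun t => 0 < t)) := by
  classical
  set P := Matrix.det (∑ k, ((X : ℝ[X]) ^ d k) • (S k).map C) with hP
  -- end scales: `a` small, `b` large, both non-singular with the end inertias, enclosing the positive roots
  obtain ⟨ε, hε, hεP⟩ : ∃ ε > 0, ∀ x, 0 < x → x < ε →
      Fintype.card {j // (isHermitian_pencil d S hS x).eigenvalues j < 0}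
          = Fintype.card {j // (isHermitian_of_isSymm (hS l₀)).eigenvalues j < 0} ∧
      Fintype.card {j // 0 < (isHermitian_pencil d S hS x).eigenvalues j}
          = Fintype.card {j // 0 < (isHermitian_of_isSymm (hS l₀)).eigenvalues j} ∧
      (∑ k, x ^ d k • S k).det ≠ 0 := by
    have h := eventually_nhdsGT_zero_indices_eq d S hS l₀ hmin h₀
    rw [eventually_nhdsWithin_iff, Metric.eventually_nhds_iff] at h
    obtain ⟨ε, hε, h⟩ := h
    exact ⟨ε, hε, fun x hx hxε => h (by rw [Real.dist_eq, sub_zero, abs_of_pos hx]; exact hxε) hx⟩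
  obtain ⟨N, hN⟩ := Filter.eventually_atTop.1 (eventually_atTop_indices_eq d S hS l₁ hmax h₁)
  have hdet : P ≠ 0 := by
    obtain ⟨-, -, h⟩ := hεP (ε / 2) (by linarith) (by linarith)
    exact det_pencil_ne_zero_of_eval d S h
  set R := P.roots.toFinset.filter (fun t => 0 < t) with hR
  -- a bound `M` for the positive roots and a positive lower bound `μ`
  obtain ⟨M, hM'⟩ := Finset.bddAbove R
  have hM : ∀ t ∈ R, t ≤ M := fun t ht => hM' (Finset.mem_coe.2 ht)
  obtain ⟨μ, hμ, hμR⟩ : ∃ μ : ℝ, 0 < μ ∧ ∀ t ∈ R, μ ≤ t := by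
    by_cases hRe : R.Nonempty
    · refine ⟨R.min' hRe, (Finset.mem_filter.1 (Finset.min'_mem R hRe)).2, fun t ht => Finset.min'_le R t ht⟩
    · exact ⟨1, one_pos, fun t ht => absurd ⟨t, ht⟩ hRe⟩
  set a := min (ε / 2) (μ / 2) with ha_def
  set b := max N (max M a + 1) with hb_def
  have ha_pos : 0 < a := by rw [ha_def]; exact lt_min (by linarith) (by linarith)
  have haε : a < ε := lt_of_le_of_lt (min_le_left _ _) (by linarith)
  obtain ⟨hνa, hπa, ha⟩ := hεP a ha_pos haε
  obtain ⟨hνb, hπb, hb⟩ := hN b (le_max_left _ _)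
  have hab : a < b := by
    have : max M a + 1 ≤ b := le_max_right _ _
    have : a ≤ max M a := le_max_right _ _
    linarith
  have hroots_in : ∀ t, 0 < t → (∑ k, t ^ d k • S k).det = 0 → a < t ∧ t < b := by
    intro t ht hdt
    have htR : t ∈ R := Finset.mem_filter.2 ⟨mem_rootSet_of_det_eq_zero d S hdet hdt, ht⟩
    have h1 := hμR t htR
    have h2 := hM t htR
    constructor
    · have : a ≤ μ / 2 := min_le_right _ _
      linarith
    · have : max M a + 1 ≤ b := le_max_right _ _
      have : M ≤ max M a := le_max_left _ _
      linarith
  obtain ⟨hν, hπ, hsum⟩ := index_formula d S hS hab ha hb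
    (fun t h1 _ hdt => htype t (lt_trans ha_pos h1) hdt) negType
    (fun t h1 _ hdt => hnegType t (lt_trans ha_pos h1) hdt)
  -- positive roots = roots in `(a, b)` for every sub-selection
  have hiff : ∀ t ∈ P.roots, (0 < t ↔ a < t ∧ t < b) := by
    intro t ht
    refine ⟨fun hpt => ?_, fun h => lt_trans ha_pos h.1⟩
    have hdt : (∑ k, t ^ d k • S k).det = 0 := by
      have h := (mem_roots hdet).1 ht
      rwa [IsRoot, DefiniteMoments.eval_det_pencil] at h
    exact hroots_in t hpt hdt
  have hf0 : P.roots.filter (fun t => 0 < t) = P.roots.filter (fun t => a < t ∧ t < b) :=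
    Multiset.filter_congr fun t ht => hiff t ht
  have hf1 : P.roots.filter (fun t => 0 < t ∧ negType t) = P.roots.filter (fun t => (a < t ∧ t < b) ∧ negType t) :=
    Multiset.filter_congr fun t ht => by rw [hiff t ht]
  have hf2 : P.roots.filter (fun t => 0 < t ∧ ¬ negType t) = P.roots.filter (fun t => (a < t ∧ t < b) ∧ ¬ negType t) :=
    Multiset.filter_congr fun t ht => by rw [hiff t ht]
  rw [hf0, hf1, hf2, ← hνa, ← hνb, ← hπa, ← hπb]
  exact ⟨hν, hπ, hsum⟩

/-! ## §3 Exact one-type counts -/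

/-- **EXACT ONE-TYPE COUNT (negative type).**  Unique extreme exponents with non-singular extreme letters; if every positive root of
`det F` is of negative type, the positive roots counted with multiplicity number EXACTLY `ν(S_{l₁}) − ν(S_{l₀}) = π(S_{l₀}) − π(S_{l₁})`.
[folklore] -/
theorem card_posRoots_multiset_eq_of_negType (d : κ → ℕ) (S : κ → Matrix ι ι ℝ) (hS : ∀ k, (S k).IsSymm) (l₀ l₁ : κ)
    (hmin : ∀ l, l ≠ l₀ → d l₀ < d l) (hmax : ∀ l, l ≠ l₁ → d l < d l₁) (h₀ : (S l₀).det ≠ 0) (h₁ : (S l₁).det ≠ 0)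
    (hneg : ∀ t, 0 < t → (∑ k, t ^ d k • S k).det = 0 → ∀ u : ι → ℝ, (∑ k, t ^ d k • S k) *ᵥ u = 0 → u ≠ 0 →
      (derivative (∑ k, C (u ⬝ᵥ (S k *ᵥ u)) * (X : ℝ[X]) ^ d k)).eval t < 0) :
    Multiset.card ((Matrix.det (∑ k, ((X : ℝ[X]) ^ d k) • (S k).map C)).roots.filter (fun t => 0 < t))
        + Fintype.card {j // (isHermitian_of_isSymm (hS l₀)).eigenvalues j < 0}
      = Fintype.card {j // (isHermitian_of_isSymm (hS l₁)).eigenvalues j < 0} ∧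
    Multiset.card ((Matrix.det (∑ k, ((X : ℝ[X]) ^ d k) • (S k).map C)).roots.filter (fun t => 0 < t))
        + Fintype.card {j // 0 < (isHermitian_of_isSymm (hS l₁)).eigenvalues j}
      = Fintype.card {j // 0 < (isHermitian_of_isSymm (hS l₀)).eigenvalues j} := by
  classical
  obtain ⟨hν, hπ, hsum⟩ := global_index_formula d S hS l₀ l₁ hmin hmax h₀ h₁
    (fun t ht hdt => Or.inl (hneg t ht hdt)) (fun _ => True) (fun t ht hdt => ⟨fun _ => hneg t ht hdt, fun _ => trivial⟩)
  have h0 : Multiset.card ((Matrix.det (∑ k, ((X : ℝ[X]) ^ d k) • (S k).map C)).roots.filter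
      (fun t => 0 < t ∧ ¬ (fun _ => True) t)) = 0 := by
    rw [Multiset.card_eq_zero, Multiset.filter_eq_nil]
    intro t _ h
    exact h.2 trivial
  rw [h0] at hν hπ hsum
  omega

/-- **EXACT ONE-TYPE COUNT (positive type)**: every positive root of positive type ⇒ the positive roots counted with multiplicity
number exactly `ν(S_{l₀}) − ν(S_{l₁}) = π(S_{l₁}) − π(S_{l₀})`. [folklore] -/
theorem card_posRoots_multiset_eq_of_posType (d : κ → ℕ) (S : κ → Matrix ι ι ℝ) (hS : ∀ k, (S k).IsSymm) (l₀ l₁ : κ)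
    (hmin : ∀ l, l ≠ l₀ → d l₀ < d l) (hmax : ∀ l, l ≠ l₁ → d l < d l₁) (h₀ : (S l₀).det ≠ 0) (h₁ : (S l₁).det ≠ 0)
    (hpos : ∀ t, 0 < t → (∑ k, t ^ d k • S k).det = 0 → ∀ u : ι → ℝ, (∑ k, t ^ d k • S k) *ᵥ u = 0 → u ≠ 0 →
      0 < (derivative (∑ k, C (u ⬝ᵥ (S k *ᵥ u)) * (X : ℝ[X]) ^ d k)).eval t) :
    Multiset.card ((Matrix.det (∑ k, ((X : ℝ[X]) ^ d k) • (S k).map C)).roots.filter (fun t => 0 < t))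
        + Fintype.card {j // (isHermitian_of_isSymm (hS l₁)).eigenvalues j < 0}
      = Fintype.card {j // (isHermitian_of_isSymm (hS l₀)).eigenvalues j < 0} ∧
    Multiset.card ((Matrix.det (∑ k, ((X : ℝ[X]) ^ d k) • (S k).map C)).roots.filter (fun t => 0 < t))
        + Fintype.card {j // 0 < (isHermitian_of_isSymm (hS l₀)).eigenvalues j}
      = Fintype.card {j // 0 < (isHermitian_of_isSymm (hS l₁)).eigenvalues j} := by
  classical
  -- a positive-type root is never of negative type (the kernel is non-trivial at a root)
  have hnot : ∀ t, 0 < t → (∑ k, t ^ d k • S k).det = 0 →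
      ¬ (∀ u : ι → ℝ, (∑ k, t ^ d k • S k) *ᵥ u = 0 → u ≠ 0 →
        (derivative (∑ k, C (u ⬝ᵥ (S k *ᵥ u)) * (X : ℝ[X]) ^ d k)).eval t < 0) := by
    intro t ht hdt hneg
    obtain ⟨u, hu0, hu⟩ := Matrix.exists_mulVec_eq_zero_iff.2 hdt
    exact absurd (hpos t ht hdt u hu hu0) (not_lt.2 (hneg u hu hu0).le)
  obtain ⟨hν, hπ, hsum⟩ := global_index_formula d S hS l₀ l₁ hmin hmax h₀ h₁
    (fun t ht hdt => Or.inr (hpos t ht hdt)) (fun _ => False) (fun t ht hdt => ⟨fun h => h.elim, fun h => hnot t ht hdt h⟩)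
  have h0 : Multiset.card ((Matrix.det (∑ k, ((X : ℝ[X]) ^ d k) • (S k).map C)).roots.filter
      (fun t => 0 < t ∧ (fun _ => False) t)) = 0 := by
    rw [Multiset.card_eq_zero, Multiset.filter_eq_nil]
    intro t _ h
    exact h.2
  have h1 : (Matrix.det (∑ k, ((X : ℝ[X]) ^ d k) • (S k).map C)).roots.filter (fun t => 0 < t ∧ ¬ (fun _ => False) t)
      = (Matrix.det (∑ k, ((X : ℝ[X]) ^ d k) • (S k).map C)).roots.filter (fun t => 0 < t) :=
    Multiset.filter_congr fun t _ => by simp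
  rw [h0, h1] at hν hπ hsum
  omega

/-! ## §4 Parity of the positive root count -/

/-- **PARITY OF `Z₊`.**  Unique extreme exponents with non-singular extreme letters (no type hypothesis): the positive roots of
`det F` counted with multiplicity have the parity of `ν(S_{l₀}) + ν(S_{l₁})`. [folklore] -/
theorem even_card_posRoots_add (d : κ → ℕ) (S : κ → Matrix ι ι ℝ) (hS : ∀ k, (S k).IsSymm) (l₀ l₁ : κ)
    (hmin : ∀ l, l ≠ l₀ → d l₀ < d l) (hmax : ∀ l, l ≠ l₁ → d l < d l₁) (h₀ : (S l₀).det ≠ 0) (h₁ : (S l₁).det ≠ 0) :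
    Even (Fintype.card {j // (isHermitian_of_isSymm (hS l₀)).eigenvalues j < 0}
      + Fintype.card {j // (isHermitian_of_isSymm (hS l₁)).eigenvalues j < 0}
      + Multiset.card ((Matrix.det (∑ k, ((X : ℝ[X]) ^ d k) • (S k).map C)).roots.filter (fun t => 0 < t))) := by
  classical
  set P := Matrix.det (∑ k, ((X : ℝ[X]) ^ d k) • (S k).map C) with hP
  obtain ⟨ε, hε, hεP⟩ : ∃ ε > 0, ∀ x, 0 < x → x < ε →
      Fintype.card {j // (isHermitian_pencil d S hS x).eigenvalues j < 0}
          = Fintype.card {j // (isHermitian_of_isSymm (hS l₀)).eigenvalues j < 0} ∧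
      Fintype.card {j // 0 < (isHermitian_pencil d S hS x).eigenvalues j}
          = Fintype.card {j // 0 < (isHermitian_of_isSymm (hS l₀)).eigenvalues j} ∧
      (∑ k, x ^ d k • S k).det ≠ 0 := by
    have h := eventually_nhdsGT_zero_indices_eq d S hS l₀ hmin h₀
    rw [eventually_nhdsWithin_iff, Metric.eventually_nhds_iff] at h
    obtain ⟨ε, hε, h⟩ := h
    exact ⟨ε, hε, fun x hx hxε => h (by rw [Real.dist_eq, sub_zero, abs_of_pos hx]; exact hxε) hx⟩
  obtain ⟨N, hN⟩ := Filter.eventually_atTop.1 (eventually_atTop_indices_eq d S hS l₁ hmax h₁)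
  have hdet : P ≠ 0 := by
    obtain ⟨-, -, h⟩ := hεP (ε / 2) (by linarith) (by linarith)
    exact det_pencil_ne_zero_of_eval d S h
  set R := P.roots.toFinset.filter (fun t => 0 < t) with hR
  obtain ⟨M, hM'⟩ := Finset.bddAbove R
  have hM : ∀ t ∈ R, t ≤ M := fun t ht => hM' (Finset.mem_coe.2 ht)
  obtain ⟨μ, hμ, hμR⟩ : ∃ μ : ℝ, 0 < μ ∧ ∀ t ∈ R, μ ≤ t := by
    by_cases hRe : R.Nonempty
    · refine ⟨R.min' hRe, (Finset.mem_filter.1 (Finset.min'_mem R hRe)).2, fun t ht => Finset.min'_le R t ht⟩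
    · exact ⟨1, one_pos, fun t ht => absurd ⟨t, ht⟩ hRe⟩
  set a := min (ε / 2) (μ / 2) with ha_def
  set b := max N (max M a + 1) with hb_def
  have ha_pos : 0 < a := by rw [ha_def]; exact lt_min (by linarith) (by linarith)
  have haε : a < ε := lt_of_le_of_lt (min_le_left _ _) (by linarith)
  obtain ⟨hνa, -, ha⟩ := hεP a ha_pos haε
  obtain ⟨hνb, -, hb⟩ := hN b (le_max_left _ _)
  have hab : a < b := by
    have : max M a + 1 ≤ b := le_max_right _ _
    have : a ≤ max M a := le_max_right _ _
    linarith
  have hroots_in : ∀ t, 0 < t → (∑ k, t ^ d k • S k).det = 0 → a < t ∧ t < b := by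
    intro t ht hdt
    have htR : t ∈ R := Finset.mem_filter.2 ⟨mem_rootSet_of_det_eq_zero d S hdet hdt, ht⟩
    have h1 := hμR t htR
    have h2 := hM t htR
    constructor
    · have : a ≤ μ / 2 := min_le_right _ _
      linarith
    · have : max M a + 1 ≤ b := le_max_right _ _
      have : M ≤ max M a := le_max_left _ _
      linarith
  have hf0 : P.roots.filter (fun t => 0 < t) = P.roots.filter (fun t => a < t ∧ t < b) := by
    refine Multiset.filter_congr fun t ht => ⟨fun hpt => ?_, fun h => lt_trans ha_pos h.1⟩
    have hdt : (∑ k, t ^ d k • S k).det = 0 := by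
      have h := (mem_roots hdet).1 ht
      rwa [IsRoot, DefiniteMoments.eval_det_pencil] at h
    exact hroots_in t hpt hdt
  have h := even_negIndex_add_negIndex_add_card_roots d S hS hab.le ha hb
  rw [hνa, hνb, ← hf0] at h
  exact h

end Pencil

end Inertia

end Summit.ValiantsHypothesis.ValiantsHypothesis.Theorems.LacunarySymmetroidMatrixDescartes
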